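import Summits.QuantumFields.BalabanUV.Beta.GAN24.CubicPushGaugeLegUnfoldingFF
import Summits.QuantumFields.BalabanUV.Beta.GAN24.CombFreeGaugeLegCharges
import Summits.QuantumFields.BalabanUV.Beta.GAN24.TransverseDictionary

/-!
# `BalabanUV.Beta.GAN24.WilsonSectorGaugeLegUnfolding` — binder row G-an2-4 ∕ (CONV-C), the (S) row ∕ (W-γ) one level up, (ζ-W):
# **THE CUBIC-WILSON SECTOR OF THE SOURCE PAIRING, UNFOLDED (every `j`): FILE A's per-slot Wilson charge read against the two responses `(H_j n, cH_j·d(φ∘blk))`,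
# plus the adjointness and Fubini tools of its level-0 evaluation**
# (G-an2-4 CRUX TEAM (2), seat `b2b-balaban-gan24-formalise-leaf-02` = SUPPLIER side of leaf-06's (C2′)∕`hX` mechanism, gen 61; PART 4a, OFFER O-leaf02-g61-1)

NOT IN PRINT; OUR BOOKKEEPING ([folklore] BY NAME over PART 3 `CubicPushGaugeLegUnfoldingFF.hasSum_prod_gaugeLeg_e3OfK_ff`, leaf-06 g47 FILE A
`CombFreeGaugeLegCharges.hasSum_prod_wilsonA_gaugeLeg` (the two-leg charge of the cubic Wilson table against `n ⊗ dψ` per slot), an2's `StepJetData.locStencil_wilsonA`, leaf-06 g46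
`RelInvWardPairing` (adjointness pattern), an5's `BalabanCompositeJets.summable_contourSum`; 0 `def`, 0 cited fact, 0 `def … : Prop`, 0 sorry).
HONEST FRAMING (cell contract, verbatim): «discharging `BetaPertH` makes Bałaban's UV stability UNCONDITIONAL — a real constructive-QFT result; it is NOT the continuum limit and NOT
the Clay problem.»  HONEST DEPENDENCY (verbatim): «continuum YM on T⁴ ⇐ BetaPertH ∧ nine spine estimates (0/9 proved); BetaPertH ⇐ (D1) ∧ (D4) ∧ CAP+tail; G-an2-4 gates asym,
D1 and NE2/3/4.»

WHY (leaf-06 g49 R1 ∕ ENGINE E31 §(B): «W = n^{−D}[½(⟨ψ⁺h, C n⟩ − (C1′)) − ¼(⟨C h, σ_ψ n⟩ + (C2′))]», exact in D = 2, 3).  The cubic member of `SrecAt 0 = S0NAt` is `cE • wilsonA`;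
inside `X_1` it is dressed by two `G_0`-legs.  PART 3 (field–field stencils) puts the slot column outside and FILE A's per-slot Wilson charge inside, read against the two
RESPONSES — §1 here, at every `j` (it is the literal Wilson table that is unfolded; in `SrecAt j`, `j ≥ 1`, the cubic member is the recursive push instead).  §2–§3 are the
generic tools the level-0 evaluation (PART 4b `WilsonSectorSourcePairingZero`) needs.
* §1 **`hasSum_prod_gaugeLeg_e3OfK_wilsonA`** (EVERY `j`, in-block root, bounded `n`, bounded `φ`):
  `Σ'_{(u,x)} Σ_κ Σ_κ₂ n κ u·dzφ κ₂ x·e3OfK Lc G_j wilsonA l t u x (inl κ)(inl κ₂)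
     = cH_j·Σ_κ′ Σ'_{u′} colH G_j Lc l t κ′ u′·(−½·(φ∘blk)(u′+e_κ′)·(d*d (H_j n))_κ′(u′) + ¼·(d*d(σ_{φ∘blk} ⊙ H_j n))_κ′(u′))`.
* §2 `tsum_mul_contourSumAdj_of_summable` — adjointness of `𝒬ᵀ` in the orientation «fine form absolutely summable, coarse form bounded» (leaf-06's
  `RelInvWardPairing.tsum_mul_contourSumAdj_bdd` is the mirror orientation; same proof).
* §3 `summable_abs_contourSum`, `summable_abs_partialContour`, `summable_abs_mul_colH`, `colM_coDressKBmAt_KInvStep_swap` (datum ↔ read-out symmetry of the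
  multiplier columns — identifies PART 2's `n`-leg weight with PART 4b's `C₀ n`), **`tsum_fieldResponse_mul_eq`** ∕ **`tsum_multResponse_mul_eq`** (the two Fubinis: the field ∕ multiplier response of the
  bounded datum `n` against an absolutely summable fine ∕ coarse form is the datum against the column pairings).
Asserts NO value of any resolvent column beyond the Ward laws quoted in PART 1; NOTHING of (C2′) ∕ `hX` ∕ (W-γ) at levels ≥ 1 ∕ (INV) ∕ (S) discharged; NEVER «G-an2-4 closed» as
(CONV-C); NOT D1, NOT `BetaPertH`, NOT continuum, NOT Clay.  2026-08-23; no existing file touched.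
-/

noncomputable section

open Finset
open scoped BigOperators
open Literature.MathematicalPhysics.QuantumFieldTheory
open Literature.MathematicalPhysics.QuantumFieldTheory.Balaban1983to89
open Literature.MathematicalPhysics.QuantumFieldTheory.Balaban1983to89.Beta
open LatticeForm (quo)
open B12Sec2to5 (l1 l1_nonneg)
open ExpKernelCalculus (Site MKer Decays Zl summable_exp_shift')
open OneStepResolventKernel (Fib LocStencil)
open AffineAveraging (Form0 Form1 box toSite unitVec unitVec_apply dz curv curvAdj contourSum)
open AffineReproduction (contourSumAdj)
open KKTFluctuationEnergy (contourSumAdj_eq)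
open AveragingContours (blk)
open OneStepKernelFamily (KInvStep colH)
open SecondOrderResponse (colM)
open StepJetData (wilsonA locStencil_wilsonA wBound)
open Summit.QuantumFields.BalabanUV.Beta.AxialDressingRooted (coDressKBmAt one_le_of_neZero)
open Summit.QuantumFields.BalabanUV.Beta.BorderedHessian (stepScale)
open Summit.QuantumFields.BalabanUV.Beta.SpineRooted (e3OfK)
open Summit.QuantumFields.BalabanUV.Beta.GAN24.RelInvWardPairing (summable_bdd_mul)
open Summit.QuantumFields.BalabanUV.Beta.GAN24.CombFreeGaugeLegCharges (hasSum_prod_wilsonA_gaugeLeg)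
open Summit.QuantumFields.BalabanUV.Beta.GAN24.CubicPushGaugeLegUnfoldingFF (hasSum_prod_gaugeLeg_e3OfK_ff)

namespace Summit.QuantumFields.BalabanUV.Beta.GAN24.WilsonSectorGaugeLegUnfolding

variable {d : ℕ}

/-! ## §1 The cubic-Wilson sector unfolded: FILE A's per-slot charge against the two responses -/

section Step

variable {Lc : ℕ} [NeZero Lc] {r : Fin (d + 1) → ℕ}

/-- NOT IN PRINT; OUR BOOKKEEPING.  **THE CUBIC-WILSON SECTOR OF THE SOURCE PAIRING, UNFOLDED** (every `j`, in-block root `ρ = toSite r`, bounded `n`, bounded coarse potential `φ`;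
`G_j = coDressKBmAt ρ Lc (KInvStep Lc j)`, `cH_j = (stepScale_j·Lc^{d+1})⁻¹`, `H_j n (κ″,y) = Σ_κ Σ'_u n κ u·colH G_j Lc κ u κ″ y`, `Ψ = φ ∘ blk Lc`):
`HasSum ((u,x) ↦ Σ_κ Σ_κ₂ n κ u·dzφ κ₂ x·e3OfK Lc G_j wilsonA l t u x (inl κ)(inl κ₂))
   (cH_j·Σ_κ′ Σ'_{u′} colH G_j Lc l t κ′ u′·(−½·Ψ(u′+e_κ′)·(d*d (H_j n)) κ′ u′ + ¼·(d*d (σ_Ψ ⊙ H_j n)) κ′ u′))`, `σ_Ψ(κ,u) = Ψ u + Ψ(u + e_κ)` —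
PART 3 at `S := wilsonA` (no multiplier rows; local by an2's `locStencil_wilsonA`) and FILE A's two-leg Wilson charge `hasSum_prod_wilsonA_gaugeLeg` per stencil bond, read with
`n := H_j n`, `ψ := Ψ`. -/
theorem hasSum_prod_gaugeLeg_e3OfK_wilsonA (hr : r ∈ box (d + 1) Lc) (j : ℕ) (l : Fin (d + 1)) (t : Site (d + 1))
    {n : Form1 (d + 1) ℝ} {Bn : ℝ} (hn : ∀ κ u, |n κ u| ≤ Bn) {φ : Site (d + 1) → ℝ} {Bφ : ℝ} (hφ : ∀ y, |φ y| ≤ Bφ) :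
    HasSum (fun ux : Site (d + 1) × Site (d + 1) => ∑ κ, ∑ κ₂, n κ ux.1 * dz φ κ₂ ux.2 *
        e3OfK Lc (coDressKBmAt (toSite r) Lc (KInvStep (d := d) Lc j)) (wilsonA d) l t ux.1 ux.2 (Sum.inl κ) (Sum.inl κ₂))
      ((stepScale d Lc j * (Lc : ℝ) ^ (d + 1))⁻¹ *
        ∑ κ', ∑' u' : Site (d + 1), colH (coDressKBmAt (toSite r) Lc (KInvStep (d := d) Lc j)) Lc l t κ' u' *
          (-(1 / 2 : ℝ) * φ (blk Lc (u' + unitVec κ'))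
              * curvAdj (curv (fun κ'' y => ∑ κ, ∑' u : Site (d + 1), n κ u * colH (coDressKBmAt (toSite r) Lc (KInvStep (d := d) Lc j)) Lc κ u κ'' y)) κ' u'
            + (1 / 4 : ℝ) * curvAdj (curv (fun κ'' y => (φ (blk Lc y) + φ (blk Lc (y + unitVec κ'')))
              * ∑ κ, ∑' u : Site (d + 1), n κ u * colH (coDressKBmAt (toSite r) Lc (KInvStep (d := d) Lc j)) Lc κ u κ'' y)) κ' u')) := by
  have hS := locStencil_wilsonA (d := d) (δ := 1) zero_le_one
  have hff : ∀ (κ' : Fin (d + 1)) (u' y w : Site (d + 1)) (m a : Fin (d + 1)), wilsonA d κ' u' y w (Sum.inr m) (Sum.inl a) = 0 :=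
    fun κ' u' y w m a => rfl
  have h := hasSum_prod_gaugeLeg_e3OfK_ff hr j hS one_pos hff l t hn hφ
  have hinner : ∀ (κ' : Fin (d + 1)) (u' : Site (d + 1)),
      (∑' yw : Site (d + 1) × Site (d + 1), ∑ κ'' : Fin (d + 1), ∑ a : Fin (d + 1),
          (∑ κ, ∑' u : Site (d + 1), n κ u * colH (coDressKBmAt (toSite r) Lc (KInvStep (d := d) Lc j)) Lc κ u κ'' yw.1)
            * dz (fun x => φ (blk Lc x)) a yw.2 * wilsonA d κ' u' yw.1 yw.2 (Sum.inl κ'') (Sum.inl a))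
        = -(1 / 2 : ℝ) * φ (blk Lc (u' + unitVec κ'))
              * curvAdj (curv (fun κ'' y => ∑ κ, ∑' u : Site (d + 1), n κ u * colH (coDressKBmAt (toSite r) Lc (KInvStep (d := d) Lc j)) Lc κ u κ'' y)) κ' u'
            + (1 / 4 : ℝ) * curvAdj (curv (fun κ'' y => (φ (blk Lc y) + φ (blk Lc (y + unitVec κ'')))
              * ∑ κ, ∑' u : Site (d + 1), n κ u * colH (coDressKBmAt (toSite r) Lc (KInvStep (d := d) Lc j)) Lc κ u κ'' y)) κ' u' :=
    fun κ' u' => (hasSum_prod_wilsonA_gaugeLeg κ' u'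
      (fun κ'' y => ∑ κ, ∑' u : Site (d + 1), n κ u * colH (coDressKBmAt (toSite r) Lc (KInvStep (d := d) Lc j)) Lc κ u κ'' y)
      (fun x => φ (blk Lc x))).tsum_eq
  simp only [hinner] at h
  exact h

/-! ## §2 Adjointness of `𝒬ᵀ`, summable fine side -/

omit [NeZero Lc] in
/-- [folklore] **ADJOINTNESS OF THE STRAIGHT-CONTOUR BLOCK SUM, THE SUMMABLE FORM ON THE FINE SIDE**: for a fine 1-form `m` with absolutely summable components and a BOUNDED
coarse 1-form `φ`, `Σ'_u Σ_κ m κ u·(𝒬ᵀ_N φ) κ u = Σ'_y Σ_κ φ κ y·(𝒬_N m) κ y` (leaf-06 g46's `RelInvWardPairing.tsum_mul_contourSumAdj_bdd` with the two roles exchanged; same shifts and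
block regrouping). -/
theorem tsum_mul_contourSumAdj_of_summable {N : ℕ} [NeZero N] {m φ : Form1 (d + 1) ℝ} {B : ℝ}
    (hm : ∀ κ, Summable fun u : Fin (d + 1) → ℤ => |m κ u|) (hφ : ∀ κ y, |φ κ y| ≤ B) :
    ∑' u, ∑ κ, m κ u * contourSumAdj N φ κ u = ∑' y, ∑ κ, φ κ y * contourSum N m κ y := by
  have hw : ∀ κ (s : ℕ), Summable fun u => m κ u * φ κ (quo N (u - (s : ℤ) • unitVec κ)) := fun κ s => by
    have h := summable_bdd_mul (f := fun u => φ κ (quo N (u - (s : ℤ) • unitVec κ))) (fun u => hφ κ _) (hm κ)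
    exact h.congr fun u => mul_comm _ _
  have hw' : ∀ κ (s : ℕ), Summable fun v => m κ (v + (s : ℤ) • unitVec κ) * φ κ (quo N v) := fun κ s => by
    have h := (Equiv.addRight ((s : ℤ) • unitVec κ)).summable_iff.2 (hw κ s)
    refine h.congr (fun v => ?_)
    simp
  have hshift : ∀ κ (s : ℕ), ∑' u, m κ u * φ κ (quo N (u - (s : ℤ) • unitVec κ)) = ∑' v, m κ (v + (s : ℤ) • unitVec κ) * φ κ (quo N v) := by
    intro κ s
    rw [← (Equiv.addRight ((s : ℤ) • unitVec κ)).tsum_eq (fun u => m κ u * φ κ (quo N (u - (s : ℤ) • unitVec κ)))]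
    exact tsum_congr fun v => by simp
  have hb : ∀ κ (s : ℕ), Summable fun y => ∑ b ∈ box (d + 1) N, m κ ((N : ℤ) • y + toSite b + (s : ℤ) • unitVec κ) * φ κ y := fun κ s => by
    have h := KKTFluctuationEnergy.summable_blocks (N := N) (hw' κ s)
    refine h.congr (fun y => Finset.sum_congr rfl fun b hb => ?_)
    rw [KKTFluctuationEnergy.quo_zsmul_add_toSite (N := N) y hb]
  calc ∑' u, ∑ κ, m κ u * contourSumAdj N φ κ u
      = ∑' u, ∑ κ, ∑ s ∈ Finset.range N, m κ u * φ κ (quo N (u - (s : ℤ) • unitVec κ)) := by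
        refine tsum_congr (fun u => Finset.sum_congr rfl (fun κ _ => ?_))
        rw [contourSumAdj_eq, Finset.mul_sum]
    _ = ∑ κ, ∑ s ∈ Finset.range N, ∑' u, m κ u * φ κ (quo N (u - (s : ℤ) • unitVec κ)) := by
        rw [Summable.tsum_finsetSum (fun κ _ => summable_sum fun s _ => hw κ s)]
        exact Finset.sum_congr rfl fun κ _ => Summable.tsum_finsetSum (fun s _ => hw κ s)
    _ = ∑ κ, ∑ s ∈ Finset.range N, ∑' y, ∑ b ∈ box (d + 1) N, m κ ((N : ℤ) • y + toSite b + (s : ℤ) • unitVec κ) * φ κ y := by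
        refine Finset.sum_congr rfl (fun κ _ => Finset.sum_congr rfl (fun s _ => ?_))
        rw [hshift, KKTFluctuationEnergy.tsum_blocks (N := N) (hw' κ s)]
        refine tsum_congr (fun y => Finset.sum_congr rfl (fun b hb => ?_))
        rw [KKTFluctuationEnergy.quo_zsmul_add_toSite (N := N) y hb]
    _ = ∑' y, ∑ κ, ∑ s ∈ Finset.range N, ∑ b ∈ box (d + 1) N, m κ ((N : ℤ) • y + toSite b + (s : ℤ) • unitVec κ) * φ κ y := by
        rw [Summable.tsum_finsetSum (fun κ _ => summable_sum fun s _ => hb κ s)]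
        exact Finset.sum_congr rfl fun κ _ => (Summable.tsum_finsetSum (fun s _ => hb κ s)).symm
    _ = ∑' y, ∑ κ, φ κ y * contourSum N m κ y := by
        refine tsum_congr (fun y => Finset.sum_congr rfl (fun κ _ => ?_))
        rw [AffineAveraging.contourSum, Finset.sum_comm, Finset.mul_sum]
        refine Finset.sum_congr rfl fun b _ => ?_
        rw [Finset.mul_sum]
        exact Finset.sum_congr rfl fun s _ => mul_comm _ _

/-! ## §3 Summabilities for the level-0 evaluation -/

omit [NeZero Lc] in
/-- [folklore] A block-contour sum of an absolutely summable 1-form is absolutely summable on the coarse lattice (an5's `summable_contourSum` on `|A|`). -/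
theorem summable_abs_contourSum {N : ℕ} [NeZero N] {A : Form1 (d + 1) ℝ} (hA : ∀ κ, Summable fun u => |A κ u|) (κ : Fin (d + 1)) :
    Summable fun Y => |contourSum N A κ Y| := by
  have h := BalabanCompositeJets.summable_contourSum N (A := fun κ u => |A κ u|) hA κ
  refine Summable.of_nonneg_of_le (fun Y => abs_nonneg _) (fun Y => ?_) h
  simp only [AffineAveraging.contourSum]
  refine (Finset.abs_sum_le_sum_abs _ _).trans (Finset.sum_le_sum fun b _ => Finset.abs_sum_le_sum_abs _ _)

/-- [folklore] The response column `u′ ↦ colH G_j Lc l t κ′ u′` (the FIELD leg) is absolutely summable, and so is every bounded multiple of it. -/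
theorem summable_abs_mul_colH (hr : r ∈ box (d + 1) Lc) (j : ℕ) (l : Fin (d + 1)) (t : Site (d + 1)) {w : Form1 (d + 1) ℝ} {B : ℝ}
    (hw : ∀ κ u, |w κ u| ≤ B) (κ' : Fin (d + 1)) :
    Summable fun u' : Site (d + 1) => |w κ' u' * colH (coDressKBmAt (toSite r) Lc (KInvStep (d := d) Lc j)) Lc l t κ' u'| := by
  have hLc : 1 ≤ Lc := one_le_of_neZero Lc
  obtain ⟨δ, C, hδ, -, hK⟩ := OneStepKernelFamily.decays_KInvStep (d := d) (Lc := Lc) j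
  obtain ⟨δG, CG, hδG, hCG, hG⟩ := Summit.QuantumFields.BalabanUV.Beta.AxialDressingRooted.decays_coDressKBmAt hLc hr (K := KInvStep (d := d) Lc j)
    ⟨δ, C, hδ, hK.nonneg (Sum.inl 0), hK⟩
  have hB : 0 ≤ B := (abs_nonneg _).trans (hw 0 0)
  refine Summable.of_nonneg_of_le (fun u' => abs_nonneg _) (fun u' => ?_) (((summable_exp_shift' hδG ((Lc : ℤ) • t)).mul_left (B * CG)))
  rw [abs_mul, mul_assoc]
  exact mul_le_mul (hw κ' u') (hG _ _ _ _) (abs_nonneg _) hB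

/-- [folklore] **FUBINI: THE FIELD RESPONSE AGAINST AN ABSOLUTELY SUMMABLE FINE FORM IS THE DATA AGAINST THE COLUMN PAIRINGS** (every `j`, in-block root, bounded `n`,
`D` with absolutely summable components): `Σ'_{u′} Σ_κ′ (H_j n)(κ′,u′)·D κ′ u′ = Σ_κ₀ Σ'_u n κ₀ u·(Σ'_{u′} Σ_κ′ D κ′ u′·colH G_j Lc κ₀ u κ′ u′)`. -/
theorem tsum_fieldResponse_mul_eq (hr : r ∈ box (d + 1) Lc) (j : ℕ) {n : Form1 (d + 1) ℝ} {Bn : ℝ} (hn : ∀ κ u, |n κ u| ≤ Bn)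
    {D : Form1 (d + 1) ℝ} (hD : ∀ κ, Summable fun u => |D κ u|) :
    ∑' u' : Site (d + 1), ∑ κ', (∑ κ₀, ∑' u : Site (d + 1), n κ₀ u * colH (coDressKBmAt (toSite r) Lc (KInvStep (d := d) Lc j)) Lc κ₀ u κ' u') * D κ' u'
      = ∑ κ₀, ∑' u : Site (d + 1), n κ₀ u *
          ∑' u' : Site (d + 1), ∑ κ', D κ' u' * colH (coDressKBmAt (toSite r) Lc (KInvStep (d := d) Lc j)) Lc κ₀ u κ' u' := by
  classical
  have hLc : 1 ≤ Lc := one_le_of_neZero Lc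
  set G : MKer (d + 1) (Fib d) := coDressKBmAt (toSite r) Lc (KInvStep (d := d) Lc j) with hGdef
  obtain ⟨δ, C, hδ, -, hK⟩ := OneStepKernelFamily.decays_KInvStep (d := d) (Lc := Lc) j
  obtain ⟨δG, CG, hδG, hCG, hG⟩ := Summit.QuantumFields.BalabanUV.Beta.AxialDressingRooted.decays_coDressKBmAt hLc hr (K := KInvStep (d := d) Lc j)
    ⟨δ, C, hδ, hK.nonneg (Sum.inl 0), hK⟩
  have hBn : 0 ≤ Bn := (abs_nonneg _).trans (hn 0 0)
  set T : ℝ := Real.exp (δG * ((Lc : ℝ) * (d + 1))) * Zl (d + 1) δG with hT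
  -- the family `(u′, u)` for fixed `(κ′, κ₀)`
  set F : Fin (d + 1) → Fin (d + 1) → Site (d + 1) → Site (d + 1) → ℝ := fun κ' κ₀ u' u =>
    n κ₀ u * colH G Lc κ₀ u κ' u' * D κ' u' with hF
  have hFs : ∀ κ' κ₀, Summable (Function.uncurry (F κ' κ₀)) := by
    intro κ' κ₀
    set M : Site (d + 1) → Site (d + 1) → ℝ := fun u' u => (Bn * CG * |D κ' u'|) * Real.exp (-δG * l1 (u' - (Lc : ℤ) • u)) with hM
    have hM0 : ∀ u' u, 0 ≤ M u' u := fun u' u => by positivity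
    have hFM : ∀ u' u, |F κ' κ₀ u' u| ≤ M u' u := by
      intro u' u
      simp only [hF, hM]
      rw [abs_mul, abs_mul]
      have e2 : |colH G Lc κ₀ u κ' u'| ≤ CG * Real.exp (-δG * l1 (u' - (Lc : ℤ) • u)) := hG _ _ _ _
      calc |n κ₀ u| * |colH G Lc κ₀ u κ' u'| * |D κ' u'| ≤ Bn * (CG * Real.exp (-δG * l1 (u' - (Lc : ℤ) • u))) * |D κ' u'| :=
            mul_le_mul (mul_le_mul (hn κ₀ u) e2 (abs_nonneg _) hBn) le_rfl (abs_nonneg _) (by positivity)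
        _ = _ := by ring
    have hMs : Summable (Function.uncurry M) := by
      refine (summable_prod_of_nonneg (fun s => hM0 s.1 s.2)).2 ⟨fun u' => ?_, ?_⟩
      · show Summable fun u => M u' u
        exact (Summit.QuantumFields.BalabanUV.Beta.GAN24.ResolventLegCharges.summable_exp_coarse' (d := d) hLc hδG u').mul_left _
      · show Summable fun u' => ∑' u, M u' u
        refine Summable.of_nonneg_of_le (fun u' => tsum_nonneg fun u => hM0 u' u) (fun u' => ?_) (((hD κ').mul_left (Bn * CG * T)))
        simp only [hM]
        rw [tsum_mul_left]
        calc (Bn * CG * |D κ' u'|) * ∑' u : Site (d + 1), Real.exp (-δG * l1 (u' - (Lc : ℤ) • u))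
            ≤ (Bn * CG * |D κ' u'|) * T :=
              mul_le_mul_of_nonneg_left (Summit.QuantumFields.BalabanUV.Beta.GAN24.ResolventLegCharges.tsum_exp_coarse_le' Lc hδG u') (by positivity)
          _ = Bn * CG * T * |D κ' u'| := by ring
    exact Summable.of_norm_bounded hMs (fun s => by rw [Real.norm_eq_abs]; exact hFM s.1 s.2)
  -- per `(κ′, κ₀)`: the two iterated sums agree; fibre summabilities in the syntactic shapes used below
  have hsw : ∀ κ' κ₀, (∑' u' : Site (d + 1), ∑' u : Site (d + 1), F κ' κ₀ u' u) = ∑' u : Site (d + 1), ∑' u' : Site (d + 1), F κ' κ₀ u' u :=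
    fun κ' κ₀ => ((hFs κ' κ₀).tsum_comm).symm
  have hprod : ∀ κ' κ₀, Summable fun u' : Site (d + 1) => ∑' u : Site (d + 1), F κ' κ₀ u' u := fun κ' κ₀ => (hFs κ' κ₀).prod
  have hprod' : ∀ κ' κ₀, Summable fun u : Site (d + 1) => ∑' u' : Site (d + 1), F κ' κ₀ u' u := fun κ' κ₀ => (hFs κ' κ₀).prod_symm.prod
  have hin : ∀ κ' κ₀ (u : Site (d + 1)), Summable fun u' : Site (d + 1) => F κ' κ₀ u' u := fun κ' κ₀ u => (hFs κ' κ₀).prod_symm.prod_factor u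
  -- assemble: LHS
  have hL : (∑' u' : Site (d + 1), ∑ κ', (∑ κ₀, ∑' u : Site (d + 1), n κ₀ u * colH G Lc κ₀ u κ' u') * D κ' u')
      = ∑ κ', ∑ κ₀, ∑' u' : Site (d + 1), ∑' u : Site (d + 1), F κ' κ₀ u' u := by
    have ept : ∀ u' : Site (d + 1), (∑ κ', (∑ κ₀, ∑' u : Site (d + 1), n κ₀ u * colH G Lc κ₀ u κ' u') * D κ' u')
        = ∑ κ', ∑ κ₀, ∑' u : Site (d + 1), F κ' κ₀ u' u := by
      intro u'
      refine Finset.sum_congr rfl fun κ' _ => ?_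
      rw [Finset.sum_mul]
      refine Finset.sum_congr rfl fun κ₀ _ => ?_
      rw [← tsum_mul_right]
    rw [tsum_congr ept, Summable.tsum_finsetSum (fun κ' _ => summable_sum fun κ₀ _ => hprod κ' κ₀)]
    exact Finset.sum_congr rfl fun κ' _ => Summable.tsum_finsetSum (fun κ₀ _ => hprod κ' κ₀)
  -- RHS
  have hR : (∑ κ₀, ∑' u : Site (d + 1), n κ₀ u * ∑' u' : Site (d + 1), ∑ κ', D κ' u' * colH G Lc κ₀ u κ' u')
      = ∑ κ₀, ∑ κ', ∑' u : Site (d + 1), ∑' u' : Site (d + 1), F κ' κ₀ u' u := by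
    refine Finset.sum_congr rfl fun κ₀ _ => ?_
    have ept : ∀ u : Site (d + 1), n κ₀ u * (∑' u' : Site (d + 1), ∑ κ', D κ' u' * colH G Lc κ₀ u κ' u')
        = ∑ κ', ∑' u' : Site (d + 1), F κ' κ₀ u' u := by
      intro u
      have hs : ∀ κ', Summable fun u' : Site (d + 1) => D κ' u' * colH G Lc κ₀ u κ' u' := fun κ' => by
        refine Summable.of_norm_bounded ((hD κ').mul_right CG) (fun u' => ?_)
        rw [Real.norm_eq_abs, abs_mul]
        refine mul_le_mul_of_nonneg_left ((hG _ _ _ _).trans ?_) (abs_nonneg _)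
        have h1 : Real.exp (-δG * l1 (u' - (Lc : ℤ) • u)) ≤ 1 := Real.exp_le_one_iff.2 (by have := l1_nonneg (u' - (Lc : ℤ) • u); nlinarith)
        exact (mul_le_mul_of_nonneg_left h1 hCG).trans (le_of_eq (mul_one _))
      rw [Summable.tsum_finsetSum (fun κ' _ => hs κ'), Finset.mul_sum]
      refine Finset.sum_congr rfl fun κ' _ => ?_
      rw [← tsum_mul_left]
      exact tsum_congr fun u' => by simp only [hF]; ring
    rw [tsum_congr ept, Summable.tsum_finsetSum (fun κ' _ => hprod' κ' κ₀)]
  rw [hL, hR, Finset.sum_comm]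
  exact Finset.sum_congr rfl fun κ₀ _ => Finset.sum_congr rfl fun κ' _ => hsw κ' κ₀

/-- [folklore] **FUBINI: THE MULTIPLIER RESPONSE AGAINST AN ABSOLUTELY SUMMABLE COARSE FORM IS THE DATA AGAINST THE MULTIPLIER-COLUMN PAIRINGS** (every `j`, in-block root,
bounded `n`, `Q` with absolutely summable components): `Σ'_Y Σ_κ (Σ_κ₀ Σ'_u n κ₀ u·colM G_j Lc κ₀ u κ Y)·Q κ Y = Σ_κ₀ Σ'_u n κ₀ u·(Σ'_Y Σ_κ Q κ Y·colM G_j Lc κ₀ u κ Y)`. -/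
theorem tsum_multResponse_mul_eq (hr : r ∈ box (d + 1) Lc) (j : ℕ) {n : Form1 (d + 1) ℝ} {Bn : ℝ} (hn : ∀ κ u, |n κ u| ≤ Bn)
    {D : Form1 (d + 1) ℝ} (hD : ∀ κ, Summable fun u => |D κ u|) :
    ∑' u' : Site (d + 1), ∑ κ', (∑ κ₀, ∑' u : Site (d + 1), n κ₀ u * colM (coDressKBmAt (toSite r) Lc (KInvStep (d := d) Lc j)) Lc κ₀ u κ' u') * D κ' u'
      = ∑ κ₀, ∑' u : Site (d + 1), n κ₀ u *
          ∑' u' : Site (d + 1), ∑ κ', D κ' u' * colM (coDressKBmAt (toSite r) Lc (KInvStep (d := d) Lc j)) Lc κ₀ u κ' u' := by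
  classical
  have hLc : 1 ≤ Lc := one_le_of_neZero Lc
  set G : MKer (d + 1) (Fib d) := coDressKBmAt (toSite r) Lc (KInvStep (d := d) Lc j) with hGdef
  obtain ⟨δ, C, hδ, -, hK⟩ := OneStepKernelFamily.decays_KInvStep (d := d) (Lc := Lc) j
  obtain ⟨δG, CG, hδG, hCG, hG⟩ := Summit.QuantumFields.BalabanUV.Beta.AxialDressingRooted.decays_coDressKBmAt hLc hr (K := KInvStep (d := d) Lc j)
    ⟨δ, C, hδ, hK.nonneg (Sum.inl 0), hK⟩
  have hBn : 0 ≤ Bn := (abs_nonneg _).trans (hn 0 0)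
  set T : ℝ := Real.exp (δG * ((Lc : ℝ) * (d + 1))) * Zl (d + 1) δG with hT
  -- the family `(u′, u)` for fixed `(κ′, κ₀)`
  set F : Fin (d + 1) → Fin (d + 1) → Site (d + 1) → Site (d + 1) → ℝ := fun κ' κ₀ u' u =>
    n κ₀ u * colM G Lc κ₀ u κ' u' * D κ' u' with hF
  have hFs : ∀ κ' κ₀, Summable (Function.uncurry (F κ' κ₀)) := by
    intro κ' κ₀
    set M : Site (d + 1) → Site (d + 1) → ℝ := fun u' u => (Bn * CG * |D κ' u'|) * Real.exp (-δG * l1 ((Lc : ℤ) • u' - (Lc : ℤ) • u)) with hM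
    have hM0 : ∀ u' u, 0 ≤ M u' u := fun u' u => by positivity
    have hFM : ∀ u' u, |F κ' κ₀ u' u| ≤ M u' u := by
      intro u' u
      simp only [hF, hM]
      rw [abs_mul, abs_mul]
      have e2 : |colM G Lc κ₀ u κ' u'| ≤ CG * Real.exp (-δG * l1 ((Lc : ℤ) • u' - (Lc : ℤ) • u)) := hG _ _ _ _
      calc |n κ₀ u| * |colM G Lc κ₀ u κ' u'| * |D κ' u'| ≤ Bn * (CG * Real.exp (-δG * l1 ((Lc : ℤ) • u' - (Lc : ℤ) • u))) * |D κ' u'| :=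
            mul_le_mul (mul_le_mul (hn κ₀ u) e2 (abs_nonneg _) hBn) le_rfl (abs_nonneg _) (by positivity)
        _ = _ := by ring
    have hMs : Summable (Function.uncurry M) := by
      refine (summable_prod_of_nonneg (fun s => hM0 s.1 s.2)).2 ⟨fun u' => ?_, ?_⟩
      · show Summable fun u => M u' u
        exact (Summit.QuantumFields.BalabanUV.Beta.GAN24.ResolventLegCharges.summable_exp_coarse' (d := d) hLc hδG ((Lc : ℤ) • u')).mul_left _
      · show Summable fun u' => ∑' u, M u' u
        refine Summable.of_nonneg_of_le (fun u' => tsum_nonneg fun u => hM0 u' u) (fun u' => ?_) (((hD κ').mul_left (Bn * CG * T)))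
        simp only [hM]
        rw [tsum_mul_left]
        calc (Bn * CG * |D κ' u'|) * ∑' u : Site (d + 1), Real.exp (-δG * l1 ((Lc : ℤ) • u' - (Lc : ℤ) • u))
            ≤ (Bn * CG * |D κ' u'|) * T :=
              mul_le_mul_of_nonneg_left (Summit.QuantumFields.BalabanUV.Beta.GAN24.ResolventLegCharges.tsum_exp_coarse_le' Lc hδG ((Lc : ℤ) • u')) (by positivity)
          _ = Bn * CG * T * |D κ' u'| := by ring
    exact Summable.of_norm_bounded hMs (fun s => by rw [Real.norm_eq_abs]; exact hFM s.1 s.2)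
  -- per `(κ′, κ₀)`: the two iterated sums agree; fibre summabilities in the syntactic shapes used below
  have hsw : ∀ κ' κ₀, (∑' u' : Site (d + 1), ∑' u : Site (d + 1), F κ' κ₀ u' u) = ∑' u : Site (d + 1), ∑' u' : Site (d + 1), F κ' κ₀ u' u :=
    fun κ' κ₀ => ((hFs κ' κ₀).tsum_comm).symm
  have hprod : ∀ κ' κ₀, Summable fun u' : Site (d + 1) => ∑' u : Site (d + 1), F κ' κ₀ u' u := fun κ' κ₀ => (hFs κ' κ₀).prod
  have hprod' : ∀ κ' κ₀, Summable fun u : Site (d + 1) => ∑' u' : Site (d + 1), F κ' κ₀ u' u := fun κ' κ₀ => (hFs κ' κ₀).prod_symm.prod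
  have hin : ∀ κ' κ₀ (u : Site (d + 1)), Summable fun u' : Site (d + 1) => F κ' κ₀ u' u := fun κ' κ₀ u => (hFs κ' κ₀).prod_symm.prod_factor u
  -- assemble: LHS
  have hL : (∑' u' : Site (d + 1), ∑ κ', (∑ κ₀, ∑' u : Site (d + 1), n κ₀ u * colM G Lc κ₀ u κ' u') * D κ' u')
      = ∑ κ', ∑ κ₀, ∑' u' : Site (d + 1), ∑' u : Site (d + 1), F κ' κ₀ u' u := by
    have ept : ∀ u' : Site (d + 1), (∑ κ', (∑ κ₀, ∑' u : Site (d + 1), n κ₀ u * colM G Lc κ₀ u κ' u') * D κ' u')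
        = ∑ κ', ∑ κ₀, ∑' u : Site (d + 1), F κ' κ₀ u' u := by
      intro u'
      refine Finset.sum_congr rfl fun κ' _ => ?_
      rw [Finset.sum_mul]
      refine Finset.sum_congr rfl fun κ₀ _ => ?_
      rw [← tsum_mul_right]
    rw [tsum_congr ept, Summable.tsum_finsetSum (fun κ' _ => summable_sum fun κ₀ _ => hprod κ' κ₀)]
    exact Finset.sum_congr rfl fun κ' _ => Summable.tsum_finsetSum (fun κ₀ _ => hprod κ' κ₀)
  -- RHS
  have hR : (∑ κ₀, ∑' u : Site (d + 1), n κ₀ u * ∑' u' : Site (d + 1), ∑ κ', D κ' u' * colM G Lc κ₀ u κ' u')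
      = ∑ κ₀, ∑ κ', ∑' u : Site (d + 1), ∑' u' : Site (d + 1), F κ' κ₀ u' u := by
    refine Finset.sum_congr rfl fun κ₀ _ => ?_
    have ept : ∀ u : Site (d + 1), n κ₀ u * (∑' u' : Site (d + 1), ∑ κ', D κ' u' * colM G Lc κ₀ u κ' u')
        = ∑ κ', ∑' u' : Site (d + 1), F κ' κ₀ u' u := by
      intro u
      have hs : ∀ κ', Summable fun u' : Site (d + 1) => D κ' u' * colM G Lc κ₀ u κ' u' := fun κ' => by
        refine Summable.of_norm_bounded ((hD κ').mul_right CG) (fun u' => ?_)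
        rw [Real.norm_eq_abs, abs_mul]
        refine mul_le_mul_of_nonneg_left ((hG _ _ _ _).trans ?_) (abs_nonneg _)
        have h1 : Real.exp (-δG * l1 ((Lc : ℤ) • u' - (Lc : ℤ) • u)) ≤ 1 := Real.exp_le_one_iff.2 (by have := l1_nonneg ((Lc : ℤ) • u' - (Lc : ℤ) • u); nlinarith)
        exact (mul_le_mul_of_nonneg_left h1 hCG).trans (le_of_eq (mul_one _))
      rw [Summable.tsum_finsetSum (fun κ' _ => hs κ'), Finset.mul_sum]
      refine Finset.sum_congr rfl fun κ' _ => ?_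
      rw [← tsum_mul_left]
      exact tsum_congr fun u' => by simp only [hF]; ring
    rw [tsum_congr ept, Summable.tsum_finsetSum (fun κ' _ => hprod' κ' κ₀)]
  rw [hL, hR, Finset.sum_comm]
  exact Finset.sum_congr rfl fun κ₀ _ => Finset.sum_congr rfl fun κ' _ => hsw κ' κ₀

omit [NeZero Lc] in
/-- [folklore] A selected partial contour sum (`EI`, `BO`, …) of an absolutely summable fine 1-form is absolutely summable on the coarse lattice. -/
theorem summable_abs_partialContour {N : ℕ} (hN : 1 ≤ N) {v : Form1 (d + 1) ℝ} (hv : ∀ κ, Summable fun u => |v κ u|) (κ : Fin (d + 1))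
    (P : (Fin (d + 1) → ℕ) → ℕ → Prop) [∀ b s, Decidable (P b s)] :
    Summable fun Y : Site (d + 1) => |∑ b ∈ box (d + 1) N, ∑ s ∈ Finset.range N, (if P b s then v κ ((N : ℤ) • Y + toSite b + (s : ℤ) • unitVec κ) else 0)| := by
  have hone : ∀ (b : Fin (d + 1) → ℕ) (s : ℕ), Summable fun Y : Site (d + 1) => |v κ ((N : ℤ) • Y + toSite b + (s : ℤ) • unitVec κ)| := by
    intro b s
    have hinj : Function.Injective fun Y : Site (d + 1) => (N : ℤ) • Y + toSite b + (s : ℤ) • unitVec κ := by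
      intro Y Y' h
      have h' : (N : ℤ) • Y = (N : ℤ) • Y' := by
        have := congrArg (fun z => z - toSite b - (s : ℤ) • unitVec κ) h
        simpa using this
      funext i
      have := congrFun h' i
      simp only [Pi.smul_apply, smul_eq_mul] at this
      exact mul_left_cancel₀ (by exact_mod_cast (by omega : N ≠ 0)) this
    exact (hv κ).comp_injective hinj
  have hmaj : Summable fun Y : Site (d + 1) => ∑ b ∈ box (d + 1) N, ∑ s ∈ Finset.range N, |v κ ((N : ℤ) • Y + toSite b + (s : ℤ) • unitVec κ)| :=
    summable_sum fun b _ => summable_sum fun s _ => hone b s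
  refine Summable.of_nonneg_of_le (fun Y => abs_nonneg _) (fun Y => ?_) hmaj
  refine (Finset.abs_sum_le_sum_abs _ _).trans (Finset.sum_le_sum fun b _ => (Finset.abs_sum_le_sum_abs _ _).trans (Finset.sum_le_sum fun s _ => ?_))
  split_ifs
  · exact le_rfl
  · rw [abs_zero]; exact abs_nonneg _

/-- [folklore] **THE MULTIPLIER COLUMNS OF `G_j` ARE SYMMETRIC UNDER DATUM ↔ READ-OUT**: `colM G_j Lc μ y κ u = colM G_j Lc κ u μ y` (co-dressing does not touch the `mm` block,
`KernelWardMColumn.colM_coDressKBmAt`; it is `wΦ_{Lc^{j+1}} κ μ (u − y)`, `MultiplierZeroMass.colM_KInvStep`; reciprocity `TransverseDictionary.wΦ_symm`).  This identifies the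
`n`-leg weight of PART 2 (`colM G_j Lc μ y₀ κ u`, datum = the border slot) with the `C₀ n` of PART 4b (`colM G_j Lc κ₀ u κ Y`, datum = the `n`-index). -/
theorem colM_coDressKBmAt_KInvStep_swap (ρ : Fin (d + 1) → ℤ) (j : ℕ) (μ : Fin (d + 1)) (y : Site (d + 1)) (κ : Fin (d + 1)) (u : Site (d + 1)) :
    colM (coDressKBmAt ρ Lc (KInvStep (d := d) Lc j)) Lc μ y κ u = colM (coDressKBmAt ρ Lc (KInvStep (d := d) Lc j)) Lc κ u μ y := by
  rw [Summit.QuantumFields.BalabanUV.Beta.KernelWardMColumn.colM_coDressKBmAt, Summit.QuantumFields.BalabanUV.Beta.KernelWardMColumn.colM_coDressKBmAt,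
    Summit.QuantumFields.BalabanUV.Beta.GAN24.MultiplierZeroMass.colM_KInvStep, Summit.QuantumFields.BalabanUV.Beta.GAN24.MultiplierZeroMass.colM_KInvStep,
    Summit.QuantumFields.BalabanUV.Beta.GAN24.TransverseDictionary.wΦ_symm, neg_sub]

end Step

end Summit.QuantumFields.BalabanUV.Beta.GAN24.WilsonSectorGaugeLegUnfolding

end
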